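import Mathlib
import HarnessLib

/-!
# ℤ9 SPECIMEN (peeled `𝔸⁴/ℤ9`, char 3), brick Z2 part 1: the `(7,4,1)`-weight ideals `W_w` and their
# stability under weight-raising endomorphisms
(crux stmt-ResolutionOfSingularities-15640 `WildQuotients.WildQuotientResolution`, line `Sketch`; S1 =
stmt-ResolutionOfSingularities-17941 `CyclicQuotientFourfolds`, non-linear sector; chain w45c card P specimen
«peeled 𝔸⁴/ℤ9» — res-L1-w45c-idea-2 memo `L/res-L1-w45c-idea-2/cardP_g12/Z9-SPECIMEN.md` §1/§4 (brick Z2),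
res-L1-w45c-plan-1 GO 2026-08-27T16:29:20Z (variant V-BR) + CLARIFICATION 16:29:52Z (letter defaults, table
form of the generator vector, «033 = Z2 NOW»); method = res-L1-w45c-stub-4's V4U weight-ideal argument
`JordanFour.I6Stable` / `I6StableJ4` transposed from `(3,2,1)` to `(7,4,1)`. [OURS · L1 W4.5c] — NOT a statement
of any manuscript; replaces the role of no printed item; AI-produced, weaker than expert review. Def-free.
Prover res-D-pv-033.)

SETTING (letters of record, plan-1 16:29:52Z (2)). `σ̄` on `k[x₁,…,xₙ]`: `σ̄ x_a = x_a`, `σ̄ x_b = x_b + x_a`,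
`σ̄ x_c = x_c + x_b`, `σ̄ x_d = x_d + x_c³ − x_a² x_c` (the peel coordinate `w = x_d`), passengers fixed — the
order-`3` automorphism of `Y₁ = 𝔸⁴/σ³ = 𝔸⁴` induced by `J₄` in characteristic `3` (memo §0). Card P's minimal
vertex `w* = (7,4,1 | 0)` gives the weighted centre; as an IDEAL blow-up the tree can type it is `Bl_{I₂₈} Y₁` with
`I₂₈ = W₂₈`, the monomial ideal of `(7,4,1)`-weight `≥ 28` in `(x_a, x_b, x_c)` (`x_d` has weight `0` and never
enters). Throughout, the WEIGHT IDEALS are written literally,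
`W_w = Ideal.span {x | ∃ i j l, w ≤ 7i + 4j + l ∧ x = x_a^i x_b^j x_c^l}`, and the 24 minimal generators of `I₂₈`
(memo §1) enter only through an ABSTRACT vector `g : Fin 24 → k[x]` with the exponent TABLE
`![(4, 0, 0), (3, 2, 0), (3, 1, 3), (3, 0, 7), (2, 4, 0), (2, 3, 2), (2, 2, 6), (2, 1, 10), (2, 0, 14), (1, 6, 0), (1, 5, 1), (1, 4, 5), (1, 3, 9), (1, 2, 13), (1, 1, 17), (1, 0, 21), (0, 7, 0), (0, 6, 4), (0, 5, 8), (0, 4, 12), (0, 3, 16), (0, 2, 20), (0, 1, 24), (0, 0, 28)]`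
(`hg : ∀ q, g q = x_a^(e q).1 x_b^(e q).2.1 x_c^(e q).2.2`; `JordanFour.I6Abstract` mould — the literal vector would make
the Rees arithmetic of Z3 unusable).

* `span_weight_mul_le` / `_pow_le` / `_mono` — `W_v W_w ⊆ W_{v+w}`, `W_v^i ⊆ W_{vi}`, monotonicity;
* `map_monomial_mem_span_weight`, **`map_span_weight_le`** — every ring endomorphism `τ` with `τ x_a = x_a`,
  `τ x_b = x_b + s x_a`, `τ x_c = x_c + t x_b + u x_a` (ANY `s t u`, ANY `τ x_d`, ANY characteristic) maps `W_w`
  into `W_w` (`τ x_a ∈ W₇`, `τ x_b ∈ W₄`, `τ x_c ∈ W₁`); in particular `σ̄(W₂₈) ⊆ W₂₈` and `σ̄⁻¹(W₂₈) ⊆ W₂₈`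
  (`σ̄⁻¹ x_b = x_b − x_a`, `σ̄⁻¹ x_c = x_c − x_b + x_a`);
(Part 2, `…Z9PeeledI28Stable`: the 24 tabulated generators span `W₂₈`; `smul_I28_pointwise`, `idealSheaf_I28_comap`,
`I28_blowup_integral_proper_birational`.)
-/

-- single-problem summit: the doubled namespace component `ResolutionOfSingularities` is forced
set_option linter.dupNamespace false

noncomputable section

open MvPolynomial

namespace Summit.ResolutionOfSingularities.ResolutionOfSingularities.Theorems.WildQuotientResolution.Z9Peeled

section Weights

variable (k : Type) [Field k] (n : ℕ) (a b c : Fin n)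

/-- **Weight ideals multiply**: `W_v · W_w ⊆ W_{v+w}` for the `(7,4,1)`-weight ideals
`W_w = (x_a^i x_b^j x_c^l : 7i + 4j + l ≥ w)`. [folklore] -/
theorem span_weight_mul_le (v w : ℕ) :
    Ideal.span {x : MvPolynomial (Fin n) k | ∃ i j l : ℕ, v ≤ 7 * i + 4 * j + l ∧
        x = X a ^ i * X b ^ j * X c ^ l} *
      Ideal.span {x : MvPolynomial (Fin n) k | ∃ i j l : ℕ, w ≤ 7 * i + 4 * j + l ∧
        x = X a ^ i * X b ^ j * X c ^ l} ≤
      Ideal.span {x : MvPolynomial (Fin n) k | ∃ i j l : ℕ, v + w ≤ 7 * i + 4 * j + l ∧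
        x = X a ^ i * X b ^ j * X c ^ l} := by
  rw [Ideal.span_mul_span']
  refine Ideal.span_le.2 ?_
  rintro _ ⟨x, ⟨i, j, l, hw, rfl⟩, y, ⟨i', j', l', hw', rfl⟩, rfl⟩
  refine Ideal.subset_span ⟨i + i', j + j', l + l', by omega, ?_⟩
  ring

/-- **Powers of weight ideals**: `W_v^i ⊆ W_{v i}`. [folklore] -/
theorem span_weight_pow_le (v : ℕ) : ∀ i : ℕ,
    Ideal.span {x : MvPolynomial (Fin n) k | ∃ i j l : ℕ, v ≤ 7 * i + 4 * j + l ∧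
        x = X a ^ i * X b ^ j * X c ^ l} ^ i ≤
      Ideal.span {x : MvPolynomial (Fin n) k | ∃ i' j l : ℕ, v * i ≤ 7 * i' + 4 * j + l ∧
        x = X a ^ i' * X b ^ j * X c ^ l}
  | 0 => by
    rw [pow_zero, Ideal.one_eq_top, top_le_iff, Ideal.eq_top_iff_one]
    exact Ideal.subset_span ⟨0, 0, 0, by omega, by simp⟩
  | i + 1 => by
    rw [pow_succ]
    refine (Ideal.mul_mono_left (span_weight_pow_le v i)).trans ?_
    refine (span_weight_mul_le k n a b c (v * i) v).trans (le_of_eq ?_)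
    rw [Nat.mul_succ]

/-- **Weight ideals decrease**: `W_v ⊆ W_w` for `w ≤ v`. [folklore] -/
theorem span_weight_mono {v w : ℕ} (h : w ≤ v) :
    Ideal.span {x : MvPolynomial (Fin n) k | ∃ i j l : ℕ, v ≤ 7 * i + 4 * j + l ∧
        x = X a ^ i * X b ^ j * X c ^ l} ≤
      Ideal.span {x : MvPolynomial (Fin n) k | ∃ i j l : ℕ, w ≤ 7 * i + 4 * j + l ∧
        x = X a ^ i * X b ^ j * X c ^ l} := by
  refine Ideal.span_mono ?_
  rintro _ ⟨i, j, l, hw, rfl⟩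
  exact ⟨i, j, l, by omega, rfl⟩

/-- **A weight-raising endomorphism maps monomials of weight `7i+4j+l` into `W_{7i+4j+l}`**: if
`τ x_a = x_a`, `τ x_b = x_b + s x_a`, `τ x_c = x_c + t x_b + u x_a` (nothing is assumed on the other
variables), then `τ(x_a^i x_b^j x_c^l) ∈ W₇^i W₄^j W₁^l ⊆ W_{7i+4j+l}`. [folklore] -/
theorem map_monomial_mem_span_weight (τ : MvPolynomial (Fin n) k →+* MvPolynomial (Fin n) k)
    (s t u : MvPolynomial (Fin n) k) (ha : τ (X a) = X a) (hb : τ (X b) = X b + s * X a)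
    (hc : τ (X c) = X c + t * X b + u * X a) (i j l : ℕ) :
    τ (X a ^ i * X b ^ j * X c ^ l) ∈
      Ideal.span {x : MvPolynomial (Fin n) k | ∃ i' j' l' : ℕ, 7 * i + 4 * j + l ≤ 7 * i' + 4 * j' + l' ∧
        x = X a ^ i' * X b ^ j' * X c ^ l'} := by
  have hXa : ∀ w, w ≤ 7 → (X a : MvPolynomial (Fin n) k) ∈
      Ideal.span {x : MvPolynomial (Fin n) k | ∃ i j l : ℕ, w ≤ 7 * i + 4 * j + l ∧
        x = X a ^ i * X b ^ j * X c ^ l} :=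
    fun w hw => Ideal.subset_span ⟨1, 0, 0, by omega, by simp⟩
  have hXb : ∀ w, w ≤ 4 → (X b : MvPolynomial (Fin n) k) ∈
      Ideal.span {x : MvPolynomial (Fin n) k | ∃ i j l : ℕ, w ≤ 7 * i + 4 * j + l ∧
        x = X a ^ i * X b ^ j * X c ^ l} :=
    fun w hw => Ideal.subset_span ⟨0, 1, 0, by omega, by simp⟩
  have hXc : (X c : MvPolynomial (Fin n) k) ∈
      Ideal.span {x : MvPolynomial (Fin n) k | ∃ i j l : ℕ, 1 ≤ 7 * i + 4 * j + l ∧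
        x = X a ^ i * X b ^ j * X c ^ l} :=
    Ideal.subset_span ⟨0, 0, 1, by omega, by simp⟩
  have h7 : τ (X a) ∈ Ideal.span {x : MvPolynomial (Fin n) k | ∃ i j l : ℕ, 7 ≤ 7 * i + 4 * j + l ∧
        x = X a ^ i * X b ^ j * X c ^ l} := by
    rw [ha]; exact hXa 7 le_rfl
  have h4 : τ (X b) ∈ Ideal.span {x : MvPolynomial (Fin n) k | ∃ i j l : ℕ, 4 ≤ 7 * i + 4 * j + l ∧
        x = X a ^ i * X b ^ j * X c ^ l} := by
    rw [hb]
    exact Ideal.add_mem _ (hXb 4 le_rfl) (Ideal.mul_mem_left _ _ (hXa 4 (by omega)))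
  have h1 : τ (X c) ∈ Ideal.span {x : MvPolynomial (Fin n) k | ∃ i j l : ℕ, 1 ≤ 7 * i + 4 * j + l ∧
        x = X a ^ i * X b ^ j * X c ^ l} := by
    rw [hc]
    exact Ideal.add_mem _ (Ideal.add_mem _ hXc (Ideal.mul_mem_left _ _ (hXb 1 (by omega))))
      (Ideal.mul_mem_left _ _ (hXa 1 (by omega)))
  rw [map_mul, map_mul, map_pow, map_pow, map_pow]
  have hmem := Ideal.mul_mem_mul (Ideal.mul_mem_mul (Ideal.pow_mem_pow h7 i) (Ideal.pow_mem_pow h4 j))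
    (Ideal.pow_mem_pow h1 l)
  have hle := (Ideal.mul_mono (Ideal.mul_mono (span_weight_pow_le k n a b c 7 i)
      (span_weight_pow_le k n a b c 4 j)) (span_weight_pow_le k n a b c 1 l)).trans
    ((Ideal.mul_mono_left (span_weight_mul_le k n a b c (7 * i) (4 * j))).trans
      (span_weight_mul_le k n a b c (7 * i + 4 * j) (1 * l)))
  simpa only [one_mul] using hle hmem

/-- **`τ(W_w) ⊆ W_w`** for every weight and every ring endomorphism `τ` of `k[x₁,…,xₙ]` with `τ x_a = x_a`,
`τ x_b = x_b + s·x_a`, `τ x_c = x_c + t·x_b + u·x_a` — ANY characteristic; `τ` is arbitrary on the other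
variables (in particular on the peel coordinate `x_d`). [folklore] -/
theorem map_span_weight_le (τ : MvPolynomial (Fin n) k →+* MvPolynomial (Fin n) k)
    (s t u : MvPolynomial (Fin n) k) (ha : τ (X a) = X a) (hb : τ (X b) = X b + s * X a)
    (hc : τ (X c) = X c + t * X b + u * X a) (w : ℕ) :
    Ideal.map τ (Ideal.span {x : MvPolynomial (Fin n) k | ∃ i j l : ℕ, w ≤ 7 * i + 4 * j + l ∧
        x = X a ^ i * X b ^ j * X c ^ l}) ≤
      Ideal.span {x : MvPolynomial (Fin n) k | ∃ i j l : ℕ, w ≤ 7 * i + 4 * j + l ∧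
        x = X a ^ i * X b ^ j * X c ^ l} := by
  rw [Ideal.map_span, Ideal.span_le]
  rintro _ ⟨_, ⟨i, j, l, hw, rfl⟩, rfl⟩
  exact span_weight_mono k n a b c hw (map_monomial_mem_span_weight k n a b c τ s t u ha hb hc i j l)

/-- **`σ̄(W_w) = W_w`** for an automorphism `σ̄` with `σ̄ x_a = x_a`, `σ̄ x_b = x_b + x_a`, `σ̄ x_c = x_c + x_b`
(the inverse is weight-raising too: `σ̄⁻¹ x_b = x_b − x_a`, `σ̄⁻¹ x_c = x_c − x_b + x_a`). [folklore] -/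
theorem map_span_weight_eq (σ : MvPolynomial (Fin n) k ≃ₐ[k] MvPolynomial (Fin n) k)
    (ha : σ (X a) = X a) (hb : σ (X b) = X b + X a) (hc : σ (X c) = X c + X b) (w : ℕ) :
    Ideal.map (σ : MvPolynomial (Fin n) k →+* MvPolynomial (Fin n) k) (Ideal.span {x : MvPolynomial (Fin n) k | ∃ i j l : ℕ, w ≤ 7 * i + 4 * j + l ∧
        x = X a ^ i * X b ^ j * X c ^ l}) =
      Ideal.span {x : MvPolynomial (Fin n) k | ∃ i j l : ℕ, w ≤ 7 * i + 4 * j + l ∧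
        x = X a ^ i * X b ^ j * X c ^ l} := by
  apply le_antisymm
  · exact map_span_weight_le k n a b c (σ : MvPolynomial (Fin n) k →+* MvPolynomial (Fin n) k) 1 1 0
      (by simpa only [RingHom.coe_coe] using ha)
      (by simpa only [RingHom.coe_coe, one_mul] using hb)
      (by simpa only [RingHom.coe_coe, one_mul, zero_mul, add_zero] using hc) w
  · have ha' : σ.symm (X a) = X a := by
      conv_lhs => rw [← ha]
      exact σ.symm_apply_apply _
    have hb' : σ.symm (X b) = X b + (-1) * X a := by
      have h := σ.symm_apply_apply (X b)
      rw [hb, map_add, ha'] at h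
      linear_combination h
    have hc' : σ.symm (X c) = X c + (-1) * X b + 1 * X a := by
      have h := σ.symm_apply_apply (X c)
      rw [hc, map_add, hb'] at h
      linear_combination h
    have hle := map_span_weight_le k n a b c (σ.symm : MvPolynomial (Fin n) k →+* MvPolynomial (Fin n) k)
      (-1) (-1) 1 (by simpa only [RingHom.coe_coe] using ha')
      (by simpa only [RingHom.coe_coe] using hb') (by simpa only [RingHom.coe_coe] using hc') w
    have hcomp : (σ : MvPolynomial (Fin n) k →+* MvPolynomial (Fin n) k).comp
        (σ.symm : MvPolynomial (Fin n) k →+* MvPolynomial (Fin n) k) = RingHom.id _ := by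
      ext x <;> simp
    calc Ideal.span {x : MvPolynomial (Fin n) k | ∃ i j l : ℕ, w ≤ 7 * i + 4 * j + l ∧
        x = X a ^ i * X b ^ j * X c ^ l}
        = Ideal.map ((σ : MvPolynomial (Fin n) k →+* MvPolynomial (Fin n) k).comp
            (σ.symm : MvPolynomial (Fin n) k →+* MvPolynomial (Fin n) k))
            (Ideal.span {x : MvPolynomial (Fin n) k | ∃ i j l : ℕ, w ≤ 7 * i + 4 * j + l ∧
        x = X a ^ i * X b ^ j * X c ^ l}) := by
          rw [hcomp, Ideal.map_id]
      _ = Ideal.map (σ : MvPolynomial (Fin n) k →+* MvPolynomial (Fin n) k)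
            (Ideal.map (σ.symm : MvPolynomial (Fin n) k →+* MvPolynomial (Fin n) k)
              (Ideal.span {x : MvPolynomial (Fin n) k | ∃ i j l : ℕ, w ≤ 7 * i + 4 * j + l ∧
        x = X a ^ i * X b ^ j * X c ^ l})) := by
          rw [Ideal.map_map]
      _ ≤ _ := Ideal.map_mono hle

end Weights

end Summit.ResolutionOfSingularities.ResolutionOfSingularities.Theorems.WildQuotientResolution.Z9Peeled

end
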